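import Summits.PneNP.PneNP.Theorems.UniformStreamUniformMagnificationVariants160471
import Literature.Computability.Complexity.StackMachines
import HarnessLib

/-!
# Route UniformStream, crux `UniformMagnification` (stmt-PneNP-16047), line `registered`,
# stub `stub_padCore`, part B: parsing, scanning, emission of the answer of `MA`

Continuing part A (`UniformStreamUniformMagnificationVariants160471.lean`: registers `PadCore.Rg`,
stores `PadCore.mk`, the logarithm `PadCore.lg`, the guard `PadCore.guardK` and the guard
pipeline `PadCore.post`), this file verifies the remaining phases of the stage-A programs of
`stub_padCore`, each with exact stores and a linear step count:

* `PadCore.oparse` — parse the outer pair word `⟨ST, b⟩ = boolPair ST [b]` two symbols per round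
  (`PadCore.runs_oparse`), and `PadCore.prefixA` = parse, pour `ST` back in order, arm the flag;
* `PadCore.scan` — re-parse the state word `ST = st·st ++ x y ++ rest` two symbols per round: an
  equal pair is a bit of `st` (kept reversed on `str`, counted in unary on `w`), the first unequal
  pair disarms the flag and the rest is only counted (twice, on `r` and `t`); a word without an
  unequal pair leaves the flag armed (`PadCore.runs_scan_sep/nil/one`);
* `PadCore.finishA` — pop the flag register of `MA` and emit: the accepted answer word
  `⟨1 · ⟨st, [b]⟩, 1ᴿ⟩` by pushes last symbol first (`PadCore.runs_finishA_good`,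
  `PadCore.boolPair_first`), or the rejecting word `⟨0 0, 1ᴿ⟩` (`PadCore.runs_finishA_bad`),
  leaving every other register empty.

Part C assembles the programs of `MA`, `MA'` and proves `stub_padCore`.

References: T. Nipkow, G. Klein, *Concrete Semantics*, Springer 2014, Ch. 7 (big-step reasoning
about structured programs); S. Arora, B. Barak, *Computational Complexity: A Modern Approach*,
CUP 2009, §1.3 (Claim 1.6).
-/

namespace Summit.PneNP.PneNP.Cruxes.UniformMagnification.Birth

set_option linter.dupNamespace false -- `Summit.PneNP.PneNP.…`: summit = sub-problem (D-0017)

open _root_.Computability Literature.Computability.Complexity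

namespace PadCore

open ACom

/-! ### The accepted answer word -/

/-- The accepted answer word of `MA`, spelled out: `⟨1 · ⟨st, [b]⟩, 1ᴿ⟩`. [folklore] -/
theorem boolPair_first (st : List Bool) (bb : Bool) (v : List Bool) :
    boolPair (true :: boolPair st [bb]) v =
      true :: true :: ((st.flatMap fun c => [c, c, c, c]) ++
        false :: false :: true :: true :: bb :: bb :: false :: true :: v) := by
  simp [boolPair, List.flatMap_append, List.flatMap_assoc]

/-! ### The outer parse of `MA` -/

/-- The inner branch of `oparse` after popping `c` and then `o`: an equal pair is a symbol of
`ST` (pushed on `s`), an unequal pair is the separator (the rest, `[b]`, goes to `b`), a missing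
partner ends the input. [folklore] -/
def oparseInner (c : Bool) : Option Bool → Prog
  | some c' => if c = c' then push .s c else pour .inp .b
  | none => skip

/-- The body of `oparse`: pop the partner symbol and branch. [folklore] -/
def oparseBody (c : Bool) : Prog := pop .inp (oparseInner c)

/-- `oparse`: read the pair word `⟨ST, b⟩` two symbols per round. [folklore] -/
def oparse : Prog := loop .inp oparseBody

/-- Effect and cost of `oparse` on `boolPair ST [b]`: `s := ST.reverse ++ s`, `b := [b]`,
`5 |ST| + 9` steps. [folklore] -/
theorem runs_oparse (bb : Bool) : ∀ (ST s : List Bool),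
    Runs oparse (mk (boolPair ST [bb]) s [] [] [] [] [] [] [] [])
      (mk [] (ST.reverse ++ s) [bb] [] [] [] [] [] [] []) (5 * ST.length + 9)
  | [], s => by
    have hin : boolPair [] [bb] = [false, true, bb] := rfl
    rw [hin]
    have hbody : Runs (oparseInner false (some true)) (mk [bb] s [] [] [] [] [] [] [] [])
        (mk [] s [bb] [] [] [] [] [] [] []) (3 * 1 + 1) := by
      have := runs_pour (Γ := Bool) (a := Rg.inp) (b := Rg.b) (by decide)
        (mk [bb] s [] [] [] [] [] [] [] [])
      rw [oparseInner, if_neg Bool.false_ne_true]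
      simpa using this
    have hpop := Runs.pop_cons' (f := oparseInner false) (k := Rg.inp) (a := true) (w := [bb])
      (R := mk [true, bb] s [] [] [] [] [] [] [] []) (R₀ := mk [bb] s [] [] [] [] [] [] [] [])
      rfl (by simp) hbody
    have h := Runs.loop_cons' (f := oparseBody) (k := Rg.inp) (a := false) (w := [true, bb])
      (R := mk [false, true, bb] s [] [] [] [] [] [] [] [])
      (R₀ := mk [true, bb] s [] [] [] [] [] [] [] []) rfl (by simp) hpop
      (Runs.loop_nil _ rfl)
    exact h.of_eq (by simp) (by norm_num)
  | c :: ST, s => by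
    have hin : boolPair (c :: ST) [bb] = c :: c :: boolPair ST [bb] := rfl
    rw [hin]
    have ih := runs_oparse bb ST (c :: s)
    have hbody : Runs (oparseInner c (some c)) (mk (boolPair ST [bb]) s [] [] [] [] [] [] [] [])
        (mk (boolPair ST [bb]) (c :: s) [] [] [] [] [] [] [] []) 1 := by
      rw [oparseInner, if_pos rfl]
      exact Runs.push' (by simp)
    have hpop := Runs.pop_cons' (f := oparseInner c) (k := Rg.inp) (a := c) (w := boolPair ST [bb])
      (R := mk (c :: boolPair ST [bb]) s [] [] [] [] [] [] [] [])
      (R₀ := mk (boolPair ST [bb]) s [] [] [] [] [] [] [] []) rfl (by simp) hbody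
    have h := Runs.loop_cons' (f := oparseBody) (k := Rg.inp) (a := c)
      (w := c :: boolPair ST [bb]) (R := mk (c :: c :: boolPair ST [bb]) s [] [] [] [] [] [] [] [])
      (R₀ := mk (c :: boolPair ST [bb]) s [] [] [] [] [] [] [] []) rfl (by simp) hpop ih
    refine h.of_eq (by simp) ?_
    simp only [List.length_cons]
    omega

/-- `prefixA`: the outer parse, pouring `ST` back in order onto `inp`, and arming the flag.
[folklore] -/
def prefixA : Prog := oparse ;; pour .s .inp ;; push .fl true

/-- Effect and cost of `prefixA`: `⟨ST, b⟩ ↦ (inp = ST, b = [b], fl = [1])`, `8 |ST| + 11` steps.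
[folklore] -/
theorem runs_prefixA (ST : List Bool) (bb : Bool) :
    Runs prefixA (mk (boolPair ST [bb]) [] [] [] [] [] [] [] [] [])
      (mk ST [] [bb] [] [] [] [] [] [true] []) (8 * ST.length + 11) := by
  unfold prefixA
  have h1 := runs_oparse bb ST []
  rw [List.append_nil] at h1
  have h2 := runs_pour (Γ := Bool) (a := Rg.s) (b := Rg.inp) (by decide)
    (mk [] ST.reverse [bb] [] [] [] [] [] [] [])
  simp only [mk_s, mk_inp, List.reverse_reverse, List.append_nil, update_mk_s, update_mk_inp,
    List.length_reverse] at h2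
  have h3 : Runs (push Rg.fl true) (mk ST [] [bb] [] [] [] [] [] [] [])
      (mk ST [] [bb] [] [] [] [] [] [true] []) 1 := Runs.push' (by simp)
  exact (h1.seq (h2.seq h3)).of_eq rfl (by omega)

/-! ### Scanning the state word -/

/-- `eatRest`: consume the rest of `inp`, one unit on each of `r` and `t` per symbol. [folklore] -/
def eatRest : Prog := loop .inp fun _ => push .r true ;; push .t true

/-- Effect and cost of `eatRest`: `4 |rest| + 1` steps. [folklore] -/
theorem runs_eatRest (s b str w cnt fl o rest r t : List Bool) :
    Runs eatRest (mk rest s b str w r t cnt fl o)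
      (mk [] s b str w (un rest.length ++ r) (un rest.length ++ t) cnt fl o)
      (4 * rest.length + 1) := by
  unfold eatRest
  have h := runs_loop_inv (k := Rg.inp) (f := fun _ => push .r true ;; push .t true)
    (fun done rest => mk rest s b str w (un done.length ++ r) (un done.length ++ t) cnt fl o)
    (fun _ _ => True) 2 (fun _ _ _ => rfl)
    (fun done x rest _ => ⟨trivial, by
      refine ((Runs.push' rfl).seq (Runs.push' ?_)).of_eq rfl (by norm_num)
      simp [List.replicate_succ]⟩)
    rest [] trivial
  simpa using h

/-- The inner branch of `scan` after popping `c` and then `o`: an equal pair is a bit of `st`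
(kept on `str`, counted on `w`); an unequal pair is the separator: disarm the flag and count the
rest; a missing partner ends the input. [folklore] -/
def scanInner (c : Bool) : Option Bool → Prog
  | some c' => if c = c' then push .str c ;; push .w true else pop .fl fun _ => eatRest
  | none => skip

/-- The body of `scan`: pop the partner symbol and branch. [folklore] -/
def scanBody (c : Bool) : Prog := pop .inp (scanInner c)

/-- `scan`: read the state word two symbols per round. [folklore] -/
def scan : Prog := loop .inp scanBody

/-- The doubled prefix as a loop segment of `scan`: `str := st.reverse ++ str`,
`w := 1^{|st|} ++ w`, `6 |st|` steps. [folklore] -/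
theorem segRuns_scan (s b r t cnt fl o : List Bool) : ∀ (st tl str w : List Bool),
    SegRuns .inp scanBody st (mk (SProg.dbl st ++ tl) s b str w r t cnt fl o)
      (mk tl s b (st.reverse ++ str) (un st.length ++ w) r t cnt fl o) (6 * st.length)
  | [], tl, str, w => by simpa using SegRuns.nil Rg.inp scanBody (mk tl s b str w r t cnt fl o)
  | c :: st, tl, str, w => by
    rw [SProg.dbl_cons, List.cons_append, List.cons_append]
    have hbody : Runs (scanInner c (some c)) (mk (SProg.dbl st ++ tl) s b str w r t cnt fl o)
        (mk (SProg.dbl st ++ tl) s b (c :: str) (true :: w) r t cnt fl o) (1 + 1) := by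
      rw [scanInner, if_pos rfl]
      exact (Runs.push' rfl).seq (Runs.push' (by simp))
    have hpop := Runs.pop_cons' (f := scanInner c) (k := Rg.inp) (a := c) (w := SProg.dbl st ++ tl)
      (R := mk (c :: (SProg.dbl st ++ tl)) s b str w r t cnt fl o)
      (R₀ := mk (SProg.dbl st ++ tl) s b str w r t cnt fl o) rfl (by simp) hbody
    have ih := segRuns_scan s b r t cnt fl o st tl (c :: str) (true :: w)
    have h := SegRuns.cons' (k := Rg.inp) (f := scanBody) (a := c) (u := st)
      (w := c :: (SProg.dbl st ++ tl))
      (R := mk (c :: c :: (SProg.dbl st ++ tl)) s b str w r t cnt fl o)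
      (R₀ := mk (c :: (SProg.dbl st ++ tl)) s b str w r t cnt fl o) rfl (by simp) hpop ih
    refine h.of_eq ?_ ?_
    · rw [un_append_cons]; simp
    · simp only [List.length_cons]; omega

/-- **`scan` on a state word with a separator**: `st·st ++ x x̄ ++ rest` with the flag armed ends
with `str = st.reverse`, `w = 1^{|st|}`, `r`, `t` topped up by `1^{|rest|}`, the flag disarmed;
`6 |st| + 4 |rest| + 8` steps. [folklore] -/
theorem runs_scan_sep (s b r t cnt fl o st : List Bool) (x : Bool) (rest : List Bool) :
    Runs scan (mk (SProg.dbl st ++ x :: (!x) :: rest) s b [] [] r t cnt (true :: fl) o)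
      (mk [] s b st.reverse (un st.length) (un rest.length ++ r) (un rest.length ++ t) cnt fl o)
      (6 * st.length + 4 * rest.length + 8) := by
  have hseg := segRuns_scan s b r t cnt (true :: fl) o st (x :: (!x) :: rest) [] []
  simp only [List.append_nil] at hseg
  have heat := runs_eatRest s b st.reverse (un st.length) cnt fl o rest r t
  have hfl : Runs (pop Rg.fl fun _ => eatRest)
      (mk rest s b st.reverse (un st.length) r t cnt (true :: fl) o)
      (mk [] s b st.reverse (un st.length) (un rest.length ++ r) (un rest.length ++ t) cnt fl o)
      (4 * rest.length + 1 + 2) :=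
    Runs.pop_cons' (k := Rg.fl) (a := true) (w := fl)
      (R₀ := mk rest s b st.reverse (un st.length) r t cnt fl o) rfl (by simp) heat
  have hbody : Runs (scanInner x (some (!x)))
      (mk rest s b st.reverse (un st.length) r t cnt (true :: fl) o)
      (mk [] s b st.reverse (un st.length) (un rest.length ++ r) (un rest.length ++ t) cnt fl o)
      (4 * rest.length + 1 + 2) := by
    rw [scanInner, if_neg (Bool.self_ne_not x)]
    exact hfl
  have hpop := Runs.pop_cons' (f := scanInner x) (k := Rg.inp) (a := !x) (w := rest)
    (R := mk ((!x) :: rest) s b st.reverse (un st.length) r t cnt (true :: fl) o)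
    (R₀ := mk rest s b st.reverse (un st.length) r t cnt (true :: fl) o) rfl (by simp) hbody
  have hloop := Runs.loop_cons' (f := scanBody) (k := Rg.inp) (a := x) (w := (!x) :: rest)
    (R := mk (x :: (!x) :: rest) s b st.reverse (un st.length) r t cnt (true :: fl) o)
    (R₀ := mk ((!x) :: rest) s b st.reverse (un st.length) r t cnt (true :: fl) o) rfl (by simp)
    hpop (Runs.loop_nil _ rfl)
  exact (hseg.runs_loop hloop).of_eq rfl (by omega)

/-- **`scan` on an even state word without separator**: only the prefix is read, the flag stays.
`6 |st| + 1` steps. [folklore] -/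
theorem runs_scan_nil (s b r t cnt fl o st : List Bool) :
    Runs scan (mk (SProg.dbl st) s b [] [] r t cnt fl o)
      (mk [] s b st.reverse (un st.length) r t cnt fl o) (6 * st.length + 1) := by
  have hseg := segRuns_scan s b r t cnt fl o st [] [] []
  simp only [List.append_nil] at hseg
  exact hseg.runs_loop_nil rfl

/-- **`scan` on an odd state word without separator**: the last symbol has no partner, the flag
stays. `6 |st| + 5` steps. [folklore] -/
theorem runs_scan_one (s b r t cnt fl o st : List Bool) (c : Bool) :
    Runs scan (mk (SProg.dbl st ++ [c]) s b [] [] r t cnt fl o)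
      (mk [] s b st.reverse (un st.length) r t cnt fl o) (6 * st.length + 5) := by
  have hseg := segRuns_scan s b r t cnt fl o st [c] [] []
  simp only [List.append_nil] at hseg
  have hbody : Runs (scanInner c none) (mk [] s b st.reverse (un st.length) r t cnt fl o)
      (mk [] s b st.reverse (un st.length) r t cnt fl o) 0 := Runs.skip _
  have hpop := Runs.pop_nil (f := scanInner c) (k := Rg.inp)
    (R := mk [] s b st.reverse (un st.length) r t cnt fl o) rfl hbody
  have hloop := Runs.loop_cons' (f := scanBody) (k := Rg.inp) (a := c) (w := [])
    (R := mk [c] s b st.reverse (un st.length) r t cnt fl o)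
    (R₀ := mk [] s b st.reverse (un st.length) r t cnt fl o) rfl (by simp) hpop
    (Runs.loop_nil _ rfl)
  exact (hseg.runs_loop hloop).of_eq rfl (by omega)

/-! ### Emission of the answer word of `MA` -/

/-- `emitQuad c`: the bit `c` four times onto `out` (a bit of `st` inside the doubly paired
answer word). [folklore] -/
def emitQuad (c : Bool) : Prog := push .out c ;; push .out c ;; push .out c ;; push .out c

/-- Effect and cost of the `st`-stage of the emission: the bits of `st`, popped from `str` last
bit first, quadrupled; `6 |st| + 1` steps. [folklore] -/
theorem runs_emitQuad_loop (i s b w r t cnt fl st o : List Bool) :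
    Runs (loop .str emitQuad) (mk i s b st.reverse w r t cnt fl o)
      (mk i s b [] w r t cnt fl ((st.flatMap fun c => [c, c, c, c]) ++ o)) (6 * st.length + 1) := by
  have h := runs_loop_inv (k := Rg.str) (f := emitQuad)
    (fun done rest => mk i s b rest w r t cnt fl ((done.flatMap fun c => [c, c, c, c]) ++ o))
    (fun _ _ => True) 4 (fun _ _ _ => rfl)
    (fun done a rest _ => ⟨trivial, by
      refine ((Runs.push' rfl).seq ((Runs.push' rfl).seq ((Runs.push' rfl).seq
        (Runs.push' ?_)))).of_eq rfl (by norm_num)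
      simp⟩)
    st.reverse [] trivial
  simpa using h

/-- `emitGoodA`: the accepted answer word `⟨1 · ⟨st, [b]⟩, 1ᴿ⟩` of `MA`, pushed last symbol first:
`1ᴿ` (from `r`), the separator, `b b`, `0 0 1 1`, the quadrupled bits of `st`, `1 1`. [folklore] -/
def emitGoodA : Prog :=
  pour .r .out ;; pushList .out [true, false] ;; (loop .b fun c => push .out c ;; push .out c) ;;
    pushList .out [true, true, false, false] ;; loop .str emitQuad ;; pushList .out [true, true]

/-- **Effect and cost of `emitGoodA`**: `3 R + 6 |st| + 15` steps. [folklore] -/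
theorem runs_emitGoodA (st : List Bool) (bb : Bool) (R : ℕ) :
    Runs emitGoodA (mk [] [] [bb] st.reverse [] (un R) [] [] [] [])
      (mk [] [] [] [] [] [] [] [] [] (boolPair (true :: boolPair st [bb]) (un R)))
      (3 * R + 6 * st.length + 15) := by
  unfold emitGoodA
  have h1 := runs_pour (Γ := Bool) (a := Rg.r) (b := Rg.out) (by decide)
    (mk [] [] [bb] st.reverse [] (un R) [] [] [] [])
  simp only [mk_r, mk_out, List.reverse_replicate, List.append_nil, update_mk_r, update_mk_out,
    List.length_replicate] at h1
  have h2 := runs_pushList (Γ := Bool) Rg.out [true, false]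
    (mk [] [] [bb] st.reverse [] [] [] [] [] (un R))
  simp only [update_mk_out, mk_out, List.reverse_cons, List.reverse_nil, List.nil_append,
    List.cons_append, List.length_cons, List.length_nil] at h2
  have h3 : Runs (loop Rg.b fun c => push .out c ;; push .out c)
      (mk [] [] [bb] st.reverse [] [] [] [] [] (false :: true :: un R))
      (mk [] [] [] st.reverse [] [] [] [] [] (bb :: bb :: false :: true :: un R)) (1 + 1 + 2 + 1) :=
    Runs.loop_cons' (k := Rg.b) (a := bb) (w := [])
      (R₀ := mk [] [] [] st.reverse [] [] [] [] [] (false :: true :: un R)) rfl (by simp)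
      ((Runs.push' rfl).seq (Runs.push' (by simp))) (Runs.loop_nil _ rfl)
  have h4 := runs_pushList (Γ := Bool) Rg.out [true, true, false, false]
    (mk [] [] [] st.reverse [] [] [] [] [] (bb :: bb :: false :: true :: un R))
  simp only [update_mk_out, mk_out, List.reverse_cons, List.reverse_nil, List.nil_append,
    List.cons_append, List.length_cons, List.length_nil] at h4
  have h5 := runs_emitQuad_loop [] [] [] [] [] [] [] [] st
    (false :: false :: true :: true :: bb :: bb :: false :: true :: un R)
  have h6 := runs_pushList (Γ := Bool) Rg.out [true, true]
    (mk [] [] [] [] [] [] [] [] [] ((st.flatMap fun c => [c, c, c, c]) ++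
      false :: false :: true :: true :: bb :: bb :: false :: true :: un R))
  simp only [update_mk_out, mk_out, List.reverse_cons, List.reverse_nil, List.nil_append,
    List.cons_append, List.length_cons, List.length_nil] at h6
  refine (h1.seq (h2.seq (h3.seq (h4.seq (h5.seq h6))))).of_eq ?_ (by omega)
  rw [boolPair_first]

/-- `emitBadA`: the rejecting answer word `⟨0 0, 1ᴿ⟩ = 0 0 0 0 0 1 1ᴿ` of `MA` (after clearing the
flag), and clearing the unused `str` and `b`. [folklore] -/
def emitBadA : Prog :=
  clear .fl ;; pour .r .out ;; pushList .out [true, false, false, false, false, false] ;;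
    clear .str ;; clear .b

/-- **Effect and cost of `emitBadA`**: `2 |fl| + 3 R + 2 |str| + 12` steps. [folklore] -/
theorem runs_emitBadA (str fl : List Bool) (bb : Bool) (R : ℕ) :
    Runs emitBadA (mk [] [] [bb] str [] (un R) [] [] fl [])
      (mk [] [] [] [] [] [] [] [] [] (boolPair [false, false] (un R)))
      (2 * fl.length + 3 * R + 2 * str.length + 12) := by
  unfold emitBadA
  have h1 := runs_clear (Γ := Bool) Rg.fl (mk [] [] [bb] str [] (un R) [] [] fl [])
  simp only [mk_fl, update_mk_fl] at h1
  have h2 := runs_pour (Γ := Bool) (a := Rg.r) (b := Rg.out) (by decide)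
    (mk [] [] [bb] str [] (un R) [] [] [] [])
  simp only [mk_r, mk_out, List.reverse_replicate, List.append_nil, update_mk_r, update_mk_out,
    List.length_replicate] at h2
  have h3 := runs_pushList (Γ := Bool) Rg.out [true, false, false, false, false, false]
    (mk [] [] [bb] str [] [] [] [] [] (un R))
  simp only [update_mk_out, mk_out, List.reverse_cons, List.reverse_nil, List.nil_append,
    List.cons_append, List.length_cons, List.length_nil] at h3
  have h4 := runs_clear (Γ := Bool) Rg.str
    (mk [] [] [bb] str [] [] [] [] [] (false :: false :: false :: false :: false :: true :: un R))
  simp only [mk_str, update_mk_str] at h4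
  have h5 := runs_clear (Γ := Bool) Rg.b
    (mk [] [] [bb] [] [] [] [] [] [] (false :: false :: false :: false :: false :: true :: un R))
  simp only [mk_b, update_mk_b, List.length_cons, List.length_nil] at h5
  exact (h1.seq (h2.seq (h3.seq (h4.seq h5)))).of_eq rfl (by omega)

/-- The dispatch of `MA` on the popped flag register: empty = accept. [folklore] -/
def dispatchA : Option Bool → Prog
  | none => emitGoodA
  | some _ => emitBadA

/-- `finishA`: pop the flag register and emit the answer word of `MA`. [folklore] -/
def finishA : Prog := pop .fl dispatchA

/-- `finishA` with an empty flag register: the accepted answer word, `3 R + 6 |st| + 17` steps.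
[folklore] -/
theorem runs_finishA_good (st : List Bool) (bb : Bool) (R : ℕ) :
    Runs finishA (mk [] [] [bb] st.reverse [] (un R) [] [] [] [])
      (mk [] [] [] [] [] [] [] [] [] (boolPair (true :: boolPair st [bb]) (un R)))
      (3 * R + 6 * st.length + 15 + 2) :=
  Runs.pop_nil (k := Rg.fl) (f := dispatchA) rfl (runs_emitGoodA st bb R)

/-- `finishA` with a nonempty flag register: the rejecting answer word,
`2 |fl| + 3 R + 2 |str| + 14` steps. [folklore] -/
theorem runs_finishA_bad (str fl : List Bool) (bb : Bool) (R : ℕ) :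
    Runs finishA (mk [] [] [bb] str [] (un R) [] [] (true :: fl) [])
      (mk [] [] [] [] [] [] [] [] [] (boolPair [false, false] (un R)))
      (2 * fl.length + 3 * R + 2 * str.length + 12 + 2) :=
  Runs.pop_cons' (k := Rg.fl) (f := dispatchA) (a := true) (w := fl)
    (R₀ := mk [] [] [bb] str [] (un R) [] [] fl []) rfl (by simp) (runs_emitBadA str fl bb R)

end PadCore

end Summit.PneNP.PneNP.Cruxes.UniformMagnification.Birth
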